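import Mathlib.Data.ZMod.Basic
import Mathlib.Algebra.Field.ZMod
import Mathlib.Data.Nat.Prime.Int
import Mathlib.Data.Fintype.Parity
import Mathlib.Tactic.NormNum.Prime
import Mathlib.Tactic.Ring
import Mathlib.Tactic.Linarith
import Mathlib.Tactic.LinearCombination
import Mathlib.Tactic.NormNum
import HarnessLib

/-!
# Venture HSemireg — the INERT-PRIME FORBIDDEN certificate of the mobility atlas: for `(m∕p) = −1` the equation
# `x² − m·y² = p·n·s²` with `n` a norm from `K = ℚ(ω)` (or `ℚ(i)`) has no solution (ENGINE-W code B, MOBILITY-ATLAS-B.md §2 law_v2,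
# the odd-`p` certificate) — kernel number theory

HONEST FRAMING. Lean index of the computation cell `pub-hsemireg`, widening group ENGINE-W (code B = the independent second code, seat
`engine-w-2`, gen 10). ELEMENTARY NUMBER THEORY ONLY (a non-residue step in the field `ℤ∕p` and an infinite descent at `p`); the mobility
atlas, node-pair classes «`{p}` reached ∕ forbidden» and THEOREM STI enter BY VALUE (docstrings). No abelian variety, sheaf, `Ext` group or
semiregularity map is constructed; nothing here says that HC, HC_CM or HC_AV holds. Theorems only (0 `def`, 0 named fact, 0 `sorry`).
Companion of code B's `TwoAdicNonNormDescent.lean` (the `p = 2` certificate): together they are the whole FORBIDDEN column of the atlas'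
LAW table. Distinct from code A's `NonNormObstructions.lean`, whose descent is at a RAMIFIED prime `ℓ ∣ D` with `k` a non-residue; here
`p ∤ m` is INERT (`m` a non-residue mod `p`) and the right-hand side carries a `K`-norm factor.

SOURCE (the cell's own result, code B): `widen/ENGINE-W/out/probe4/MOBILITY-ATLAS-B.md` §2 (v1.0, engine-w-2 g4): «FORBIDDEN certificates:
(odd `p ∤ m`) „`(m∕p) = −1` and `v_p(n)` is even for `n ∈ N(K^×)ℚ^{×2}` ⇒ `(p·n·s², m)_p = −1`"; … ALLOWED: explicit `p·n = a² − m·b²` with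
`n ∈ N(K^×)` (`n = u² + uv + v²`)» — machine leg law_v2 in `codeB/cmp_atlas_AB.py`: all 60 `E_ω⁶` cells and every reached `E_i⁶` class equal
to code A's THEOREM-STI column (`cmp_atlas_Ew6_AB.json` 204∕204, `cmp_atlas_Ei6_AB.json` 71∕71). The class `{p}` of a node-pair image with
node field `k′ = ℚ(√m)` on `E_K⁶` is reached only if `p·n·s² = x² − m y²` is solvable with `n ∈ N(K^×)`, `s ≠ 0`; the certificate says it is
not when `m` is a non-residue mod `p` (for `K = ℚ(ω)` the atlas primes are `p ≡ 2 (mod 3)`, so `−3` is a non-residue too and `v_p(n)` is even).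
What the kernel holds (valuation-free: a descent on `|u| + |v| + |s|` replaces «`v_p` even ∕ odd»):

* §1 `dvd_of_nonresidue` — `p` prime, `m` a non-residue mod `p`, `p ∣ x² − m y²` ⇒ `p ∣ x ∧ p ∣ y` (in the field `ℤ∕p`);
  `eisenstein_norm_step` — `p` an odd prime with `−3` a non-residue: `p ∣ u² + uv + v²` ⇒ `p ∣ u ∧ p ∣ v` (via `4n = (2u+v)² + 3v²`);
  `gauss_norm_step` — `−1` a non-residue: `p ∣ u² + v²` ⇒ `p ∣ u ∧ p ∣ v`.
* §2 **`no_solution_of_norm_step`** — for ANY binary form `n(u,v) = u² + c·uv + d·v²` with the step property «`p ∣ n(u,v) ⇒ p ∣ u, v`» and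
  `m` a non-residue mod `p`: `x² − m y² = p·n(u,v)·s²` has no solution with `(u, v) ≠ 0`, `s ≠ 0` (strong induction on `|u| + |v| + |s|`:
  `p ∣ x, y`, then `p ∣ n(u,v)·s²`, and either `s ↦ s∕p` or `(u,v) ↦ (u∕p, v∕p)` shrinks the measure).
* §3 **`forbidden_eisenstein`** (`K = ℚ(ω)`, `n = u² + uv + v²`) and **`forbidden_gauss`** (`K = ℚ(i)`, `n = u² + v²`).
* §4 the FORBIDDEN cells of record of the `E_ω⁶` table (§2 of the source; `(m, p)` with `(m∕p) = −1`, all `p ≡ 2 (mod 3)`):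
  `cells_sqrt_neg1` (`p = 11, 23, 47, 59`), `cells_sqrt_neg2` (`5, 23, 29, 47, 53`), `cells_sqrt_neg7` (`5, 17, 41, 47, 59`), `cells_sqrt_neg11`
  (`17, 29, 41`), `cells_sqrt2` (`5, 11, 29, 53, 59`), `cells_sqrt5` (`17, 23, 47, 53`) — 26 cells, the non-residue facts by `decide`.
WHAT IS NOT HERE: the atlas, THEOREM STI, the ALLOWED identities (tabulated in the source; cf. `TwoAdicNonNormDescent.allowed_identities`),
the `E_i⁶` cell list (same theorem `forbidden_gauss`, primes `p ≡ 3 (mod 4)`), the 3-adic obstruction for `3 ∣ m`. Tier of the source: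
machine ×2 across codes and methods (LAW column) + hand ×1 (B).
-/

namespace Summit.Ventures.HSemireg.InertPrimeNonNorm

/-! ## §1 The non-residue steps -/

/-- **Non-residue step**: `p` prime, `m` not a square mod `p`; then `p ∣ x² − m·y²` forces `p ∣ x` and `p ∣ y` (if `p ∤ y` then
`m = (x∕y)²` in the field `ℤ∕p`). [kernel] -/
theorem dvd_of_nonresidue {p : ℕ} (hp : p.Prime) {m : ℤ} (hm : ¬ IsSquare ((m : ℤ) : ZMod p)) {x y : ℤ}
    (h : (p : ℤ) ∣ x ^ 2 - m * y ^ 2) : (p : ℤ) ∣ x ∧ (p : ℤ) ∣ y := by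
  haveI : Fact p.Prime := ⟨hp⟩
  have hmod : ((x ^ 2 - m * y ^ 2 : ℤ) : ZMod p) = 0 := (ZMod.intCast_zmod_eq_zero_iff_dvd _ p).2 h
  push_cast at hmod
  have hy : (y : ZMod p) = 0 := by
    by_contra hy
    apply hm
    refine ⟨(x : ZMod p) * (y : ZMod p)⁻¹, ?_⟩
    have hyy : (y : ZMod p) * (y : ZMod p)⁻¹ = 1 := mul_inv_cancel₀ hy
    have hx2 : (x : ZMod p) ^ 2 = (m : ZMod p) * (y : ZMod p) ^ 2 := by linear_combination hmod
    calc ((m : ℤ) : ZMod p) = (m : ZMod p) * ((y : ZMod p) * (y : ZMod p)⁻¹) ^ 2 := by rw [hyy]; ring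
      _ = ((m : ZMod p) * (y : ZMod p) ^ 2) * ((y : ZMod p)⁻¹) ^ 2 := by ring
      _ = (x : ZMod p) ^ 2 * ((y : ZMod p)⁻¹) ^ 2 := by rw [← hx2]
      _ = (x : ZMod p) * (y : ZMod p)⁻¹ * ((x : ZMod p) * (y : ZMod p)⁻¹) := by ring
  have hx : (x : ZMod p) = 0 := by
    rw [hy] at hmod
    have : (x : ZMod p) ^ 2 = 0 := by linear_combination hmod
    exact pow_eq_zero_iff (n := 2) (by norm_num) |>.1 this
  exact ⟨(ZMod.intCast_zmod_eq_zero_iff_dvd x p).1 hx, (ZMod.intCast_zmod_eq_zero_iff_dvd y p).1 hy⟩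

/-- **Eisenstein norm step** (`K = ℚ(ω)`): `p` an odd prime with `−3` a non-residue mod `p` (i.e. `p ≡ 2 (mod 3)`, `p` inert in `K`);
then `p ∣ u² + uv + v²` forces `p ∣ u` and `p ∣ v` — via `4(u² + uv + v²) = (2u + v)² − (−3)·v²`. [kernel] -/
theorem eisenstein_norm_step {p : ℕ} (hp : p.Prime) (hp2 : p ≠ 2) (h3 : ¬ IsSquare ((-3 : ℤ) : ZMod p)) {u v : ℤ}
    (h : (p : ℤ) ∣ u ^ 2 + u * v + v ^ 2) : (p : ℤ) ∣ u ∧ (p : ℤ) ∣ v := by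
  have h4 : (p : ℤ) ∣ (2 * u + v) ^ 2 - (-3) * v ^ 2 := by
    have e : (2 * u + v) ^ 2 - (-3) * v ^ 2 = 4 * (u ^ 2 + u * v + v ^ 2) := by ring
    rw [e]; exact dvd_mul_of_dvd_right h 4
  obtain ⟨h2u, hv⟩ := dvd_of_nonresidue hp h3 h4
  have hpZ : Prime (p : ℤ) := Nat.prime_iff_prime_int.1 hp
  have h2u' : (p : ℤ) ∣ 2 * u := by
    have : (2 * u : ℤ) = (2 * u + v) - v := by ring
    rw [this]; exact dvd_sub h2u hv
  refine ⟨?_, hv⟩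
  rcases hpZ.dvd_or_dvd h2u' with h2 | hu
  · exfalso
    have : p ∣ 2 := by exact_mod_cast h2
    have := (Nat.prime_dvd_prime_iff_eq hp Nat.prime_two).1 this
    exact hp2 this
  · exact hu

/-- **Gauss norm step** (`K = ℚ(i)`): `−1` a non-residue mod `p` (`p ≡ 3 (mod 4)`); then `p ∣ u² + v²` forces `p ∣ u`, `p ∣ v`. [kernel] -/
theorem gauss_norm_step {p : ℕ} (hp : p.Prime) (h1 : ¬ IsSquare ((-1 : ℤ) : ZMod p)) {u v : ℤ}
    (h : (p : ℤ) ∣ u ^ 2 + v ^ 2) : (p : ℤ) ∣ u ∧ (p : ℤ) ∣ v := by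
  have h' : (p : ℤ) ∣ u ^ 2 - (-1) * v ^ 2 := by
    have e : u ^ 2 - (-1) * v ^ 2 = u ^ 2 + v ^ 2 := by ring
    rw [e]; exact h
  exact dvd_of_nonresidue hp h1 h'

/-! ## §2 The descent -/

/-- **No solution, for any `K`-norm form with the step property.** `p` prime, `m` a non-residue mod `p`, `n(u,v) = u² + c·uv + d·v²` with
«`p ∣ n(u,v) ⇒ p ∣ u ∧ p ∣ v`»; then `x² − m·y² = p·n(u,v)·s²` has no integer solution with `(u, v) ≠ (0, 0)` and `s ≠ 0`. [kernel] -/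
theorem no_solution_of_norm_step {p : ℕ} (hp : p.Prime) {m c d : ℤ} (hm : ¬ IsSquare ((m : ℤ) : ZMod p))
    (hstep : ∀ u v : ℤ, (p : ℤ) ∣ u ^ 2 + c * u * v + d * v ^ 2 → (p : ℤ) ∣ u ∧ (p : ℤ) ∣ v) :
    ∀ u v s x y : ℤ, (u ≠ 0 ∨ v ≠ 0) → s ≠ 0 → x ^ 2 - m * y ^ 2 ≠ (p : ℤ) * (u ^ 2 + c * u * v + d * v ^ 2) * s ^ 2 := by
  have hpZ : Prime (p : ℤ) := Nat.prime_iff_prime_int.1 hp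
  have hp0 : (p : ℤ) ≠ 0 := by exact_mod_cast hp.ne_zero
  have hp1 : 1 < p := hp.one_lt
  suffices H : ∀ n : ℕ, ∀ u v s x y : ℤ, u.natAbs + v.natAbs + s.natAbs ≤ n → (u ≠ 0 ∨ v ≠ 0) → s ≠ 0 →
      x ^ 2 - m * y ^ 2 ≠ (p : ℤ) * (u ^ 2 + c * u * v + d * v ^ 2) * s ^ 2 by
    intro u v s x y; exact H _ u v s x y le_rfl
  intro n
  induction n using Nat.strong_induction_on with
  | _ n ih =>
    intro u v s x y hn huv hs h
    -- p ∣ x and p ∣ y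
    have hpx : (p : ℤ) ∣ x ^ 2 - m * y ^ 2 := ⟨(u ^ 2 + c * u * v + d * v ^ 2) * s ^ 2, by rw [h]; ring⟩
    obtain ⟨⟨x₁, rfl⟩, ⟨y₁, rfl⟩⟩ := dvd_of_nonresidue hp hm hpx
    -- p (x₁² − m y₁²) = n(u,v) s²
    have h1 : (p : ℤ) * (x₁ ^ 2 - m * y₁ ^ 2) = (u ^ 2 + c * u * v + d * v ^ 2) * s ^ 2 := by
      have h' : (p : ℤ) * ((p : ℤ) * (x₁ ^ 2 - m * y₁ ^ 2)) = (p : ℤ) * ((u ^ 2 + c * u * v + d * v ^ 2) * s ^ 2) := by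
        linear_combination h
      exact mul_left_cancel₀ hp0 h'
    have hdvd : (p : ℤ) ∣ (u ^ 2 + c * u * v + d * v ^ 2) * s ^ 2 := ⟨_, h1.symm⟩
    rcases hpZ.dvd_or_dvd hdvd with hn1 | hs2
    · -- p ∣ n(u,v) ⇒ p ∣ u, v: shrink (u, v)
      obtain ⟨⟨u₁, rfl⟩, ⟨v₁, rfl⟩⟩ := hstep u v hn1
      have h2 : x₁ ^ 2 - m * y₁ ^ 2 = (p : ℤ) * (u₁ ^ 2 + c * u₁ * v₁ + d * v₁ ^ 2) * s ^ 2 := by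
        have h' : (p : ℤ) * (x₁ ^ 2 - m * y₁ ^ 2) = (p : ℤ) * ((p : ℤ) * (u₁ ^ 2 + c * u₁ * v₁ + d * v₁ ^ 2) * s ^ 2) := by
          rw [h1]; ring
        exact mul_left_cancel₀ hp0 h'
      have huv₁ : u₁ ≠ 0 ∨ v₁ ≠ 0 := by
        rcases huv with hu | hv
        · left; rintro rfl; exact hu (by ring)
        · right; rintro rfl; exact hv (by ring)
      have hmeas : u₁.natAbs + v₁.natAbs + s.natAbs < n := by
        have e1 : ((p : ℤ) * u₁).natAbs = p * u₁.natAbs := by rw [Int.natAbs_mul, Int.natAbs_natCast]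
        have e2 : ((p : ℤ) * v₁).natAbs = p * v₁.natAbs := by rw [Int.natAbs_mul, Int.natAbs_natCast]
        rw [e1, e2] at hn
        have hpos : 0 < u₁.natAbs + v₁.natAbs := by
          rcases huv₁ with hu | hv
          · have := Int.natAbs_pos.2 hu; omega
          · have := Int.natAbs_pos.2 hv; omega
        nlinarith
      exact ih _ hmeas u₁ v₁ s x₁ y₁ le_rfl huv₁ hs h2
    · -- p ∣ s² ⇒ p ∣ s: shrink s
      have hs1 : (p : ℤ) ∣ s := hpZ.dvd_of_dvd_pow hs2
      obtain ⟨s₁, rfl⟩ := hs1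
      have h2 : x₁ ^ 2 - m * y₁ ^ 2 = (p : ℤ) * (u ^ 2 + c * u * v + d * v ^ 2) * s₁ ^ 2 := by
        have h' : (p : ℤ) * (x₁ ^ 2 - m * y₁ ^ 2) = (p : ℤ) * ((p : ℤ) * (u ^ 2 + c * u * v + d * v ^ 2) * s₁ ^ 2) := by
          rw [h1]; ring
        exact mul_left_cancel₀ hp0 h'
      have hs₁ : s₁ ≠ 0 := by rintro rfl; exact hs (by ring)
      have hmeas : u.natAbs + v.natAbs + s₁.natAbs < n := by
        have e3 : ((p : ℤ) * s₁).natAbs = p * s₁.natAbs := by rw [Int.natAbs_mul, Int.natAbs_natCast]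
        rw [e3] at hn
        have hpos : 0 < s₁.natAbs := Int.natAbs_pos.2 hs₁
        nlinarith
      exact ih _ hmeas u v s₁ x₁ y₁ le_rfl huv hs₁ h2

/-! ## §3 The two `K`'s of the atlas -/

/-- **FORBIDDEN certificate for `E_ω⁶` (`K = ℚ(ω)`).** `p` an odd prime with `m` and `−3` non-residues mod `p`; then
`x² − m·y² ≠ p·(u² + uv + v²)·s²` whenever `(u, v) ≠ 0`, `s ≠ 0`: no node-pair class `{p}` with node field `ℚ(√m)` is reached. [kernel] -/
theorem forbidden_eisenstein {p : ℕ} (hp : p.Prime) (hp2 : p ≠ 2) {m : ℤ} (hm : ¬ IsSquare ((m : ℤ) : ZMod p))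
    (h3 : ¬ IsSquare ((-3 : ℤ) : ZMod p)) (u v s x y : ℤ) (huv : u ≠ 0 ∨ v ≠ 0) (hs : s ≠ 0) :
    x ^ 2 - m * y ^ 2 ≠ (p : ℤ) * (u ^ 2 + u * v + v ^ 2) * s ^ 2 := by
  have := no_solution_of_norm_step hp (c := 1) (d := 1) hm
    (fun u v h => eisenstein_norm_step hp hp2 h3 (by simpa [one_mul] using h)) u v s x y huv hs
  simpa [one_mul] using this

/-- **FORBIDDEN certificate for `E_i⁶` (`K = ℚ(i)`).** `p` prime with `m` and `−1` non-residues mod `p`; then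
`x² − m·y² ≠ p·(u² + v²)·s²` whenever `(u, v) ≠ 0`, `s ≠ 0`. [kernel] -/
theorem forbidden_gauss {p : ℕ} (hp : p.Prime) {m : ℤ} (hm : ¬ IsSquare ((m : ℤ) : ZMod p))
    (h1 : ¬ IsSquare ((-1 : ℤ) : ZMod p)) (u v s x y : ℤ) (huv : u ≠ 0 ∨ v ≠ 0) (hs : s ≠ 0) :
    x ^ 2 - m * y ^ 2 ≠ (p : ℤ) * (u ^ 2 + v ^ 2) * s ^ 2 := by
  have := no_solution_of_norm_step hp (c := 0) (d := 1) hm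
    (fun u v h => gauss_norm_step hp h1 (by simpa using h)) u v s x y huv hs
  simpa using this

/-! ## §4 The FORBIDDEN cells of record (`E_ω⁶` LAW table, MOBILITY-ATLAS-B.md §2) -/

/-- `ℚ(i)` row: `p = 11, 23, 47, 59` are FORBIDDEN (`(−1∕p) = −1`). [kernel] -/
theorem cells_sqrt_neg1 (u v s x y : ℤ) (huv : u ≠ 0 ∨ v ≠ 0) (hs : s ≠ 0) :
    x ^ 2 - (-1) * y ^ 2 ≠ (11 : ℕ) * (u ^ 2 + u * v + v ^ 2) * s ^ 2 ∧
      x ^ 2 - (-1) * y ^ 2 ≠ (23 : ℕ) * (u ^ 2 + u * v + v ^ 2) * s ^ 2 ∧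
      x ^ 2 - (-1) * y ^ 2 ≠ (47 : ℕ) * (u ^ 2 + u * v + v ^ 2) * s ^ 2 ∧
      x ^ 2 - (-1) * y ^ 2 ≠ (59 : ℕ) * (u ^ 2 + u * v + v ^ 2) * s ^ 2 := by
  refine ⟨forbidden_eisenstein (by norm_num) (by norm_num) (by decide) (by decide) u v s x y huv hs,
    forbidden_eisenstein (by norm_num) (by norm_num) (by decide) (by decide) u v s x y huv hs,
    forbidden_eisenstein (by norm_num) (by norm_num) (by decide) (by decide) u v s x y huv hs,
    forbidden_eisenstein (by norm_num) (by norm_num) (by decide) (by decide) u v s x y huv hs⟩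

/-- `ℚ(√−2)` row: `p = 5, 23, 29, 47, 53` are FORBIDDEN. [kernel] -/
theorem cells_sqrt_neg2 (u v s x y : ℤ) (huv : u ≠ 0 ∨ v ≠ 0) (hs : s ≠ 0) :
    x ^ 2 - (-2) * y ^ 2 ≠ (5 : ℕ) * (u ^ 2 + u * v + v ^ 2) * s ^ 2 ∧
      x ^ 2 - (-2) * y ^ 2 ≠ (23 : ℕ) * (u ^ 2 + u * v + v ^ 2) * s ^ 2 ∧
      x ^ 2 - (-2) * y ^ 2 ≠ (29 : ℕ) * (u ^ 2 + u * v + v ^ 2) * s ^ 2 ∧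
      x ^ 2 - (-2) * y ^ 2 ≠ (47 : ℕ) * (u ^ 2 + u * v + v ^ 2) * s ^ 2 ∧
      x ^ 2 - (-2) * y ^ 2 ≠ (53 : ℕ) * (u ^ 2 + u * v + v ^ 2) * s ^ 2 := by
  refine ⟨forbidden_eisenstein (by norm_num) (by norm_num) (by decide) (by decide) u v s x y huv hs,
    forbidden_eisenstein (by norm_num) (by norm_num) (by decide) (by decide) u v s x y huv hs,
    forbidden_eisenstein (by norm_num) (by norm_num) (by decide) (by decide) u v s x y huv hs,
    forbidden_eisenstein (by norm_num) (by norm_num) (by decide) (by decide) u v s x y huv hs,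
    forbidden_eisenstein (by norm_num) (by norm_num) (by decide) (by decide) u v s x y huv hs⟩

/-- `ℚ(√−7)` row: `p = 5, 17, 41, 47, 59` are FORBIDDEN. [kernel] -/
theorem cells_sqrt_neg7 (u v s x y : ℤ) (huv : u ≠ 0 ∨ v ≠ 0) (hs : s ≠ 0) :
    x ^ 2 - (-7) * y ^ 2 ≠ (5 : ℕ) * (u ^ 2 + u * v + v ^ 2) * s ^ 2 ∧
      x ^ 2 - (-7) * y ^ 2 ≠ (17 : ℕ) * (u ^ 2 + u * v + v ^ 2) * s ^ 2 ∧
      x ^ 2 - (-7) * y ^ 2 ≠ (41 : ℕ) * (u ^ 2 + u * v + v ^ 2) * s ^ 2 ∧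
      x ^ 2 - (-7) * y ^ 2 ≠ (47 : ℕ) * (u ^ 2 + u * v + v ^ 2) * s ^ 2 ∧
      x ^ 2 - (-7) * y ^ 2 ≠ (59 : ℕ) * (u ^ 2 + u * v + v ^ 2) * s ^ 2 := by
  refine ⟨forbidden_eisenstein (by norm_num) (by norm_num) (by decide) (by decide) u v s x y huv hs,
    forbidden_eisenstein (by norm_num) (by norm_num) (by decide) (by decide) u v s x y huv hs,
    forbidden_eisenstein (by norm_num) (by norm_num) (by decide) (by decide) u v s x y huv hs,
    forbidden_eisenstein (by norm_num) (by norm_num) (by decide) (by decide) u v s x y huv hs,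
    forbidden_eisenstein (by norm_num) (by norm_num) (by decide) (by decide) u v s x y huv hs⟩

/-- `ℚ(√−11)` row: `p = 17, 29, 41` are FORBIDDEN. [kernel] -/
theorem cells_sqrt_neg11 (u v s x y : ℤ) (huv : u ≠ 0 ∨ v ≠ 0) (hs : s ≠ 0) :
    x ^ 2 - (-11) * y ^ 2 ≠ (17 : ℕ) * (u ^ 2 + u * v + v ^ 2) * s ^ 2 ∧
      x ^ 2 - (-11) * y ^ 2 ≠ (29 : ℕ) * (u ^ 2 + u * v + v ^ 2) * s ^ 2 ∧
      x ^ 2 - (-11) * y ^ 2 ≠ (41 : ℕ) * (u ^ 2 + u * v + v ^ 2) * s ^ 2 := by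
  refine ⟨forbidden_eisenstein (by norm_num) (by norm_num) (by decide) (by decide) u v s x y huv hs,
    forbidden_eisenstein (by norm_num) (by norm_num) (by decide) (by decide) u v s x y huv hs,
    forbidden_eisenstein (by norm_num) (by norm_num) (by decide) (by decide) u v s x y huv hs⟩

/-- Silver `ℚ(√2)` row: `p = 5, 11, 29, 53, 59` are FORBIDDEN. [kernel] -/
theorem cells_sqrt2 (u v s x y : ℤ) (huv : u ≠ 0 ∨ v ≠ 0) (hs : s ≠ 0) :
    x ^ 2 - 2 * y ^ 2 ≠ (5 : ℕ) * (u ^ 2 + u * v + v ^ 2) * s ^ 2 ∧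
      x ^ 2 - 2 * y ^ 2 ≠ (11 : ℕ) * (u ^ 2 + u * v + v ^ 2) * s ^ 2 ∧
      x ^ 2 - 2 * y ^ 2 ≠ (29 : ℕ) * (u ^ 2 + u * v + v ^ 2) * s ^ 2 ∧
      x ^ 2 - 2 * y ^ 2 ≠ (53 : ℕ) * (u ^ 2 + u * v + v ^ 2) * s ^ 2 ∧
      x ^ 2 - 2 * y ^ 2 ≠ (59 : ℕ) * (u ^ 2 + u * v + v ^ 2) * s ^ 2 := by
  refine ⟨forbidden_eisenstein (by norm_num) (by norm_num) (by decide) (by decide) u v s x y huv hs,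
    forbidden_eisenstein (by norm_num) (by norm_num) (by decide) (by decide) u v s x y huv hs,
    forbidden_eisenstein (by norm_num) (by norm_num) (by decide) (by decide) u v s x y huv hs,
    forbidden_eisenstein (by norm_num) (by norm_num) (by decide) (by decide) u v s x y huv hs,
    forbidden_eisenstein (by norm_num) (by norm_num) (by decide) (by decide) u v s x y huv hs⟩

/-- Golden `ℚ(√5)` row: `p = 17, 23, 47, 53` are FORBIDDEN. [kernel] -/
theorem cells_sqrt5 (u v s x y : ℤ) (huv : u ≠ 0 ∨ v ≠ 0) (hs : s ≠ 0) :
    x ^ 2 - 5 * y ^ 2 ≠ (17 : ℕ) * (u ^ 2 + u * v + v ^ 2) * s ^ 2 ∧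
      x ^ 2 - 5 * y ^ 2 ≠ (23 : ℕ) * (u ^ 2 + u * v + v ^ 2) * s ^ 2 ∧
      x ^ 2 - 5 * y ^ 2 ≠ (47 : ℕ) * (u ^ 2 + u * v + v ^ 2) * s ^ 2 ∧
      x ^ 2 - 5 * y ^ 2 ≠ (53 : ℕ) * (u ^ 2 + u * v + v ^ 2) * s ^ 2 := by
  refine ⟨forbidden_eisenstein (by norm_num) (by norm_num) (by decide) (by decide) u v s x y huv hs,
    forbidden_eisenstein (by norm_num) (by norm_num) (by decide) (by decide) u v s x y huv hs,
    forbidden_eisenstein (by norm_num) (by norm_num) (by decide) (by decide) u v s x y huv hs,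
    forbidden_eisenstein (by norm_num) (by norm_num) (by decide) (by decide) u v s x y huv hs⟩

end Summit.Ventures.HSemireg.InertPrimeNonNorm
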